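import Summits.AtomisticToContinuum.BoseEinsteinCondensation.Theorems.BECHusimiAmplitudeGasHusimiConcentrationForm
import Summits.AtomisticToContinuum.BoseEinsteinCondensation.Theorems.BECHusimiAmplitudeGasHusimiConcentrationGaussian

/-!
# Husimi concentration, IV: finiteness and non-vanishing of the Husimi mass; measurability

Part of the proof, for route `BECHusimiAmplitudeGas` of `AtomisticToContinuum/BoseEinsteinCondensation`,
that the Laplace-principle node `HusimiConcentration` (item stmt-AtomisticToContinuum-11994) follows
from the two cap estimates `PhaseCapDecay` (stmt-11990) and `AmplitudeLDP` (stmt-11991) — the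
content of the glue item `LaplaceCapUnion` (stmt-11995). Setting (generic over a finite index type
`ι` of modes with an injective labelling `m : ι → ℤ³`, `m i₀ = 0`): scaled plane waves
`e_i = e_{m i}/√L³` on the cell `[0,L)³`, `u_c = ∑ᵢ cᵢ eᵢ` for `c : ι → ℂ`, the degree-`N` form
`F(g) = ∫_{cell^N} ∏ⱼ conj g(xⱼ) Ψ(X) dX`, the Gaussian weight `w(c) = e^{-∑|cᵢ|²}` on
`ι → ℂ ≅ ℝ^{2|ι|}` (Lebesgue measure), and the word integrals
`J_k = ∫_{cell^N} ∏ⱼ conj e_{kⱼ}(xⱼ) Ψ` for words `k : Fin N → ι`.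

This file: the two unconditional side-conjuncts of `HusimiConcentration` —
`∫ w |F(u_c)|² < ∞` (`lintegral_weight_mul_form_lt_top`: polynomial growth against Gaussian
moments) and `∫ w |F(u_c)|² ≠ 0` for a nonnegative continuous `Ψ` with `∫_{cell^N}|Ψ|² = 1`
(`lintegral_weight_mul_form_ne_zero`: the form is continuous in `c` and equals
`(√L³)^{-N} ∫Ψ > 0` at the constant direction `c = δ_{i₀}`) — and the measurability in `c` of the
amplitude overlap `⟨|u_c|, φ₀⟩` (`measurable_ovAbs`, a parametric integral). All [folklore].
-/

noncomputable section

namespace Summit.AtomisticToContinuum.BoseEinsteinCondensation.Theorems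

open MeasureTheory
open scoped ENNReal NNReal ComplexConjugate BigOperators
open Literature.MathematicalPhysics.QuantumManyBody.BoseGas
open Literature.Probability.RandomMatrix

namespace HusimiConcentration

variable {ι : Type*} [Fintype ι] {N : ℕ} {L : ℝ}

/-- **Finiteness of the Husimi mass**: `∫ e^{-|c|²} |F(u_c)|² dc < ∞` (polynomial growth of the
form against Gaussian moments). [folklore] -/
theorem lintegral_weight_mul_form_lt_top (m : ι → (Fin 3 → ℤ)) {Ψ : Config N → ℂ} (hΨ : Continuous Ψ) :
    ∫⁻ c : ι → ℂ, ENNReal.ofReal (Real.exp (-∑ i, ‖c i‖ ^ 2)) *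
      ((‖∫ X in cellN N L, (∏ j, conj (∑ i, c i *
        (cellWave L (m i) (X j) / (Real.sqrt (L ^ 3) : ℂ)))) * Ψ X‖₊ : ℝ≥0∞) ^ 2) < ⊤ := by
  classical
  set K : ℝ := ∑ k : Fin N → ι,
    ‖∫ X in cellN N L, (∏ j, conj (cellWave L (m (k j)) (X j) / (Real.sqrt (L ^ 3) : ℂ))) * Ψ X‖
    with hK
  have hK0 : 0 ≤ K := Finset.sum_nonneg fun k _ => norm_nonneg _
  set d : ℕ := Fintype.card ι with hd
  -- pointwise bound by `K² dᴺ · e^{-S} Sᴺ`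
  have hpt : ∀ c : ι → ℂ, ENNReal.ofReal (Real.exp (-∑ i, ‖c i‖ ^ 2)) *
      ((‖∫ X in cellN N L, (∏ j, conj (∑ i, c i *
        (cellWave L (m i) (X j) / (Real.sqrt (L ^ 3) : ℂ)))) * Ψ X‖₊ : ℝ≥0∞) ^ 2) ≤
      ENNReal.ofReal (K ^ 2 * (d : ℝ) ^ N) * (ENNReal.ofReal (Real.exp (-∑ i, ‖c i‖ ^ 2)) *
        ENNReal.ofReal (∑ i, ‖c i‖ ^ 2) ^ N) := by
    intro c
    have h1 := norm_form_le (L := L) m hΨ c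
    have hS0 : 0 ≤ ∑ i, ‖c i‖ ^ 2 := Finset.sum_nonneg fun i _ => by positivity
    have hcs : (∑ i, ‖c i‖) ^ 2 ≤ (d : ℝ) * ∑ i, ‖c i‖ ^ 2 := by
      have := sq_sum_le_card_mul_sum_sq (s := (Finset.univ : Finset ι)) (f := fun i => ‖c i‖)
      simpa [hd] using this
    have h2 : ‖∫ X in cellN N L, (∏ j, conj (∑ i, c i *
        (cellWave L (m i) (X j) / (Real.sqrt (L ^ 3) : ℂ)))) * Ψ X‖ ^ 2 ≤
        K ^ 2 * (d : ℝ) ^ N * (∑ i, ‖c i‖ ^ 2) ^ N := by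
      calc _ ≤ (K * (∑ i, ‖c i‖) ^ N) ^ 2 := pow_le_pow_left₀ (norm_nonneg _) h1 2
        _ = K ^ 2 * ((∑ i, ‖c i‖) ^ 2) ^ N := by ring
        _ ≤ K ^ 2 * ((d : ℝ) * ∑ i, ‖c i‖ ^ 2) ^ N := by
            gcongr
        _ = _ := by ring
    rw [coe_nnnorm_sq_eq_ofReal, ← ENNReal.ofReal_pow hS0]
    refine (mul_le_mul_right (ENNReal.ofReal_le_ofReal h2) _).trans (le_of_eq ?_)
    rw [ENNReal.ofReal_mul (by positivity)]
    ring
  refine lt_of_le_of_lt (lintegral_mono hpt) ?_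
  rw [lintegral_const_mul' _ _ ENNReal.ofReal_ne_top]
  exact ENNReal.mul_lt_top ENNReal.ofReal_lt_top (lintegral_exp_neg_nsq_mul_pow_lt_top N)

/-- For a nonnegative continuous `Ψ` with `∫_{cell^N} |Ψ|² = 1`, `∫_{cell^N} Ψ ≠ 0`. [folklore] -/
theorem integral_cellN_ne_zero {Ψ : Config N → ℂ} (hΨ : Continuous Ψ)
    (hΨpos : ∀ X, Ψ X = ((‖Ψ X‖ : ℝ) : ℂ)) (hnorm : ∫⁻ X in cellN N L, (‖Ψ X‖₊ : ℝ≥0∞) ^ 2 = 1) :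
    ∫ X in cellN N L, Ψ X ≠ 0 := by
  intro h0
  have h1 : ∫ X in cellN N L, Ψ X = ((∫ X in cellN N L, ‖Ψ X‖ : ℝ) : ℂ) := by
    rw [← integral_complex_ofReal]
    exact integral_congr_ae (Filter.Eventually.of_forall fun X => hΨpos X)
  rw [h1, Complex.ofReal_eq_zero] at h0
  have hint : Integrable (fun X => ‖Ψ X‖) (volume.restrict (cellN N L)) :=
    (integrableOn_cellN hΨ L).norm
  have hae := (integral_eq_zero_iff_of_nonneg (fun X => norm_nonneg _) hint).1 h0
  have h2 : ∫⁻ X in cellN N L, (‖Ψ X‖₊ : ℝ≥0∞) ^ 2 = 0 := by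
    rw [lintegral_eq_zero_iff' (by fun_prop)]
    filter_upwards [hae] with X hX
    simp only [Pi.zero_apply, norm_eq_zero] at hX
    simp [hX]
  rw [h2] at hnorm
  exact zero_ne_one hnorm

/-- **Non-vanishing of the Husimi mass**: `∫ e^{-|c|²} |F(u_c)|² dc ≠ 0` for a nonnegative
continuous normalised `Ψ` (the form is continuous in `c` and equals `(√L³)^{-N}∫Ψ > 0` at the
constant direction `c = δ_{i₀}`, `m i₀ = 0`). [folklore] -/
theorem lintegral_weight_mul_form_ne_zero (hL : 0 < L) [DecidableEq ι] (m : ι → (Fin 3 → ℤ)) (i₀ : ι)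
    (hi₀ : m i₀ = 0) {Ψ : Config N → ℂ} (hΨ : Continuous Ψ) (hΨpos : ∀ X, Ψ X = ((‖Ψ X‖ : ℝ) : ℂ))
    (hnorm : ∫⁻ X in cellN N L, (‖Ψ X‖₊ : ℝ≥0∞) ^ 2 = 1) :
    ∫⁻ c : ι → ℂ, ENNReal.ofReal (Real.exp (-∑ i, ‖c i‖ ^ 2)) *
      ((‖∫ X in cellN N L, (∏ j, conj (∑ i, c i *
        (cellWave L (m i) (X j) / (Real.sqrt (L ^ 3) : ℂ)))) * Ψ X‖₊ : ℝ≥0∞) ^ 2) ≠ 0 := by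
  set Fu : (ι → ℂ) → ℂ := fun c => ∫ X in cellN N L, (∏ j, conj (∑ i, c i *
    (cellWave L (m i) (X j) / (Real.sqrt (L ^ 3) : ℂ)))) * Ψ X with hFu
  -- the continuous real density
  set g : (ι → ℂ) → ℝ := fun c => Real.exp (-∑ i, ‖c i‖ ^ 2) * ‖Fu c‖ ^ 2 with hg
  have hgc : Continuous g := by
    refine Continuous.mul (Real.continuous_exp.comp continuous_nsq.neg) ?_
    exact ((continuous_form m hΨ).norm).pow 2
  -- positivity at the constant direction
  set c₀ : ι → ℂ := Pi.single i₀ 1 with hc₀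
  have hF0 : Fu c₀ ≠ 0 := by
    have h1 : Fu c₀ = ∫ X in cellN N L, (∏ j : Fin N, conj (cellWave L (m i₀) (X j) /
        (Real.sqrt (L ^ 3) : ℂ))) * Ψ X := form_single m hΨ i₀
    rw [h1, wordIntegral_const m i₀ hi₀ Ψ]
    refine mul_ne_zero ?_ (integral_cellN_ne_zero hΨ hΨpos hnorm)
    have : (0 : ℝ) < (Real.sqrt (L ^ 3))⁻¹ ^ N := by positivity
    exact_mod_cast this.ne'
  have hg0 : 0 < g c₀ := mul_pos (Real.exp_pos _) (by positivity)
  -- an open set of positive measure on which the integrand is `≥ g c₀ / 2`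
  set U : Set (ι → ℂ) := {c | g c₀ / 2 < g c} with hU
  have hUo : IsOpen U := isOpen_lt continuous_const hgc
  have hUne : U.Nonempty := ⟨c₀, by simp [hU, hg0]⟩
  have hUpos : 0 < volume U := hUo.measure_pos volume hUne
  have hle : ∫⁻ c, U.indicator (fun _ => ENNReal.ofReal (g c₀ / 2)) c ≤
      ∫⁻ c : ι → ℂ, ENNReal.ofReal (Real.exp (-∑ i, ‖c i‖ ^ 2)) * ((‖Fu c‖₊ : ℝ≥0∞) ^ 2) := by
    refine lintegral_mono fun c => ?_
    rw [coe_nnnorm_sq_eq_ofReal, ← ENNReal.ofReal_mul (Real.exp_pos _).le]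
    by_cases hc : c ∈ U
    · rw [Set.indicator_of_mem hc]
      exact ENNReal.ofReal_le_ofReal (le_of_lt hc)
    · rw [Set.indicator_of_notMem hc]
      exact bot_le
  rw [lintegral_indicator_const hUo.measurableSet] at hle
  intro h0
  rw [h0, nonpos_iff_eq_zero, mul_eq_zero] at hle
  rcases hle with h | h
  · rw [ENNReal.ofReal_eq_zero] at h
    linarith
  · exact hUpos.ne' h

omit [Fintype ι] in
/-- The amplitude overlap `c ↦ ⟨|u_c|, φ₀⟩ = ∫_{cell} conj(|u_c(x)|) φ₀(x) dx` is measurable in the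
coefficients (a parametric integral of a jointly measurable integrand). [folklore] -/
theorem measurable_ovAbs [Fintype ι] (m : ι → (Fin 3 → ℤ)) :
    Measurable fun c : ι → ℂ => ∫ x in cell L,
      conj (((‖∑ i, c i * (cellWave L (m i) x / (Real.sqrt (L ^ 3) : ℂ))‖ : ℝ) : ℂ)) *
        constantMode L x := by
  have hsm : StronglyMeasurable (Function.uncurry fun (c : ι → ℂ) (x : Space) =>
      conj (((‖∑ i, c i * (cellWave L (m i) x / (Real.sqrt (L ^ 3) : ℂ))‖ : ℝ) : ℂ)) *
        constantMode L x) := by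
    refine Measurable.stronglyMeasurable (Measurable.mul ?_ ?_)
    · refine (Complex.continuous_conj.measurable.comp (Complex.continuous_ofReal.measurable.comp
        (Continuous.measurable ?_).norm))
      refine continuous_finsetSum _ fun i _ => ?_
      exact ((continuous_apply i).comp continuous_fst).mul
        (((continuous_cellWave L (m i)).comp continuous_snd).div_const _)
    · have hcm : Measurable (constantMode L) :=
        measurable_const.indicator (measurableSet_cell L)
      exact hcm.comp measurable_snd
  exact (hsm.integral_prod_right (ν := volume.restrict (cell L))).measurable



end HusimiConcentration

end Summit.AtomisticToContinuum.BoseEinsteinCondensation.Theorems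

end
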